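import Summits.AtomisticToContinuum.HydrodynamicLimit.Theses.LambertianContactSwap
import Summits.AtomisticToContinuum.HydrodynamicLimit.Theorems.RelayRaceLocalityLightConeInLawStubTimeZero
import Literature.MathematicalPhysics.KineticTheory.LambertianHardSphereFlow
import HarnessLib

/-!
# `SwapGap` is implied by the conjunct: `LocalGibbsProbability → LambertianEuler → HydrodynamicLimit → SwapGap`

Structural helper for the crux `SwapGap` (stmt-AtomisticToContinuum-11850) of route
`LambertianContactSwap`. Together with the route's typed glue
`MergingTransfer : LocalGibbsProbability → SwapGap → LambertianEuler → HydrodynamicLimit`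
(stmt-12099, proved) this records that, GIVEN the route's random-model crux `LambertianEuler` (and the
proved `LocalGibbsProbability`), the derandomisation crux `SwapGap` is EQUIVALENT to the sub-problem
statement `HydrodynamicLimit`: it is neither a weakening nor a strengthening of the conjunct (the
refuter's crux-attack note, now a theorem), and it is the second half of the composition of the
`moment-matched-dice` transfer (`TransferBack`), whose first half is `MergingTransfer` for the matched gas.

Proof (Portmanteau towards a CONSTANT, twice): fix profiles, `σ₀ := min (1/2) (min σ_P (min σ_L σ_H))`;
for `σ < σ₀`, Euler data, flows, the `t = 0` hypothesis, `t < T`, `χ`, `F`, let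
`c := (∫χρ_t, ∫χρ_t u_t, ∫χE_t)`. `HydrodynamicLimit` gives convergence in `P_N`-probability of the
field triple of `Φ_t` to `c` (sup distance: union bound over the three fields), hence
`∫ F(fld(Φ_t z)) dP_N → F(c)` (`tendsto_integral_of_tendsto_measure_dist`); `LambertianEuler` gives the
same for the Lambertian flow under `P_N ⊗ γ^ℕ` (the Lambertian `let` block is the Literature API
`lambertFlow`/`lambertNoise` definitionally; jointly measurable for `σ < 1/2`,
`measurable_lambertFlow_hsDiameter`), hence `∫ F(fld(Λ_t)) d(P_N ⊗ γ^ℕ) → F(c)`; subtract.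

prover-line-stmt-AtomisticToContinuum-11850-0, cycle 1.
-/

noncomputable section

open MeasureTheory Filter Set Topology
open scoped ENNReal

namespace Summit.AtomisticToContinuum.HydrodynamicLimit.Theorems

open Literature.Analysis.FluidPDE Literature.MathematicalPhysics.KineticTheory
open Summit.AtomisticToContinuum.HydrodynamicLimit.Theses.LambertianContactSwap

/-- **Union bound for the sup distance on the field triple.** On any measure space, if the three
deviation probabilities `μ_N{δ < |d_N − a|}`, `μ_N{δ < ‖m_N − b‖}`, `μ_N{δ < |e_N − c|}` tend to `0`
for a given `δ`, then so does `μ_N{δ < dist (d_N, m_N, e_N) (a, b, c)}`. [folklore] -/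
theorem tendsto_measure_dist_triple {Ω : ℕ → Type*} [∀ N, MeasurableSpace (Ω N)]
    (μ : (N : ℕ) → Measure (Ω N)) (X : (N : ℕ) → Ω N → ℝ × V3 × ℝ) (L : ℝ × V3 × ℝ) {δ : ℝ}
    (h1 : Tendsto (fun N => μ N {ω | δ < |(X N ω).1 - L.1|}) atTop (𝓝 0))
    (h2 : Tendsto (fun N => μ N {ω | δ < ‖(X N ω).2.1 - L.2.1‖}) atTop (𝓝 0))
    (h3 : Tendsto (fun N => μ N {ω | δ < |(X N ω).2.2 - L.2.2|}) atTop (𝓝 0)) :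
    Tendsto (fun N => μ N {ω | δ < dist (X N ω) L}) atTop (𝓝 0) := by
  have hsub : ∀ N, {ω | δ < dist (X N ω) L} ⊆
      {ω | δ < |(X N ω).1 - L.1|} ∪ {ω | δ < ‖(X N ω).2.1 - L.2.1‖} ∪
        {ω | δ < |(X N ω).2.2 - L.2.2|} := by
    intro N ω hω
    simp only [mem_setOf_eq] at hω
    rw [Prod.dist_eq, Prod.dist_eq, Real.dist_eq, dist_eq_norm, Real.dist_eq] at hω
    simp only [mem_union, mem_setOf_eq]
    rcases lt_max_iff.1 hω with h | h
    · exact Or.inl (Or.inl h)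
    · rcases lt_max_iff.1 h with h' | h'
      · exact Or.inl (Or.inr h')
      · exact Or.inr h'
  have hle : ∀ N, μ N {ω | δ < dist (X N ω) L} ≤
      μ N {ω | δ < |(X N ω).1 - L.1|} + μ N {ω | δ < ‖(X N ω).2.1 - L.2.1‖} +
        μ N {ω | δ < |(X N ω).2.2 - L.2.2|} := fun N =>
    (measure_mono (hsub N)).trans
      ((measure_union_le _ _).trans (add_le_add (measure_union_le _ _) le_rfl))
  have h0 : Tendsto (fun N => μ N {ω | δ < |(X N ω).1 - L.1|} +
      μ N {ω | δ < ‖(X N ω).2.1 - L.2.1‖} + μ N {ω | δ < |(X N ω).2.2 - L.2.2|}) atTop (𝓝 0) := by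
    simpa using (h1.add h2).add h3
  exact tendsto_of_tendsto_of_tendsto_of_le_of_le tendsto_const_nhds h0 (fun N => zero_le) hle

/-- **`SwapGap` from the conjunct, the Lambertian Euler theorem and the probability lemma.**
`LocalGibbsProbability → LambertianEuler → HydrodynamicLimit → SwapGap`: both expectations in the
crux converge to `F(∫χρ_t, ∫χρ_t u_t, ∫χE_t)` (convergence in probability to a constant plus
bounded-Lipschitz `F`, for the deterministic flow by `HydrodynamicLimit` and for the Lambertian flow by
`LambertianEuler`), so their difference tends to `0`. With `MergingTransfer` (stmt-12099) this makes
`SwapGap` equivalent to `HydrodynamicLimit` given `LambertianEuler`. [cite: Dudley2002, §11.3] -/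
theorem swapGap_of_hydrodynamicLimit (hP : LocalGibbsProbability) (hL : LambertianEuler)
    (hH : Literature.MathematicalPhysics.KineticTheory.HydrodynamicLimit) : SwapGap := by
  delta Summit.AtomisticToContinuum.HydrodynamicLimit.Theses.LambertianContactSwap.SwapGap
  intro Cfg G ε τ S ldir lpair lstep lstate linst lflow noise fld a₀ θ₀ u₀ ha hθ hu ha0 hθ0
  obtain ⟨σP, hσP, hP'⟩ := hP
  obtain ⟨σL, hσL, hL'⟩ := hL a₀ θ₀ u₀ ha hθ hu ha0 hθ0
  obtain ⟨σH, hσH, hH'⟩ := hH a₀ θ₀ u₀ ha hθ hu ha0 hθ0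
  refine ⟨min 2⁻¹ (min σP (min σL σH)), lt_min (by norm_num) (lt_min hσP (lt_min hσL hσH)), ?_⟩
  intro σ hσ hσlt T ρ θ u hE Φ P h0 t ht χ hχ F hF hF1
  have hσhalf : σ < 2⁻¹ := hσlt.trans_le (min_le_left _ _)
  have hσP' : σ < σP := hσlt.trans_le ((min_le_right _ _).trans (min_le_left _ _))
  have hσL' : σ < σL :=
    hσlt.trans_le ((min_le_right _ _).trans ((min_le_right _ _).trans (min_le_left _ _)))
  have hσH' : σ < σH :=
    hσlt.trans_le ((min_le_right _ _).trans ((min_le_right _ _).trans (min_le_right _ _)))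
  have hPN : ∀ N, IsProbabilityMeasure (P N) :=
    fun N => hP' σ hσ hσP' a₀ θ₀ u₀ ha hθ hu ha0 hθ0 N (Φ N)
  have hnoise : IsProbabilityMeasure noise := by
    show IsProbabilityMeasure (lambertNoise (Fin 3))
    infer_instance
  have hQN : ∀ N, IsProbabilityMeasure ((P N).prod noise) := fun N => by
    haveI := hPN N
    infer_instance
  -- the two convergence-in-probability inputs at time `t`
  have hHt := hH' σ hσ hσH' T ρ θ u hE Φ h0 t ht χ hχ
  have hLt := hL' σ hσ hσL' T ρ θ u hE Φ h0 t ht χ hχ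
  -- the common limit
  set c : ℝ × V3 × ℝ := (∫ x, χ x * ρ t x, ∫ x, (χ x * ρ t x) • u t x,
    ∫ x, χ x * totalEnergyDensity (ρ t x) (u t x) (θ t x)) with hc
  -- measurability
  have hfld : ∀ N, Measurable fun y : Cfg N => fld N y χ := fun N =>
    (measurable_empiricalDensityField hχ).prodMk
      ((measurable_empiricalMomentumField hχ).prodMk (measurable_empiricalEnergyField hχ))
  have hΛ : ∀ N, Measurable fun p : Cfg N × (ℕ → EuclideanSpace ℝ (Fin 3)) => lflow σ N p.2 p.1 t :=
    fun N => measurable_lambertFlow_hsDiameter hσ.le hσhalf N t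
  -- deterministic side
  have hΦside : Tendsto (fun N => ∫ z, F (fld N ((Φ N).flow t z) χ) ∂P N) atTop (𝓝 (F c)) :=
    LightConeInLawSketch.TimeZero.tendsto_integral_of_tendsto_measure_dist P hPN
      (fun N z => fld N ((Φ N).flow t z) χ) (fun N => (hfld N).comp ((Φ N).measurable_flow t)) c F
      hF hF1 fun δ hδ => tendsto_measure_dist_triple P (fun N z => fld N ((Φ N).flow t z) χ) c
        (hHt δ hδ).1 (hHt δ hδ).2.1 (hHt δ hδ).2.2
  -- Lambertian side
  have hΛside : Tendsto (fun N => ∫ p, F (fld N (lflow σ N p.2 p.1 t) χ) ∂(P N).prod noise) atTop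
      (𝓝 (F c)) :=
    LightConeInLawSketch.TimeZero.tendsto_integral_of_tendsto_measure_dist
      (fun N => (P N).prod noise) hQN (fun N p => fld N (lflow σ N p.2 p.1 t) χ)
      (fun N => (hfld N).comp (hΛ N)) c F hF hF1 fun δ hδ =>
        tendsto_measure_dist_triple (fun N => (P N).prod noise)
          (fun N p => fld N (lflow σ N p.2 p.1 t) χ) c (hLt δ hδ).1 (hLt δ hδ).2.1 (hLt δ hδ).2.2
  have h := hΦside.sub hΛside
  rwa [sub_self] at h

end Summit.AtomisticToContinuum.HydrodynamicLimit.Theorems
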